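import Summits.CriticalPhenomena.PercolationContinuityZ3.Theorems.Transplant.PlanarSkeletonFrmFromDefs
import Summits.CriticalPhenomena.PercolationContinuityZ3.Theorems.Transplant.SkelFrmFromBChoiceDefsT
import Summits.CriticalPhenomena.PercolationContinuityZ3.Theorems.Transplant.SkelFrmBChoiceDefsT
import Summits.CriticalPhenomena.PercolationContinuityZ3.Theorems.Transplant.SkelNeg1ChoiceAll
import HarnessLib
import Summits.CriticalPhenomena.PercolationContinuityZ3.Theorems.Transplant.SkelFrmBChoiceGeomT
/-!
# U-WAVE PORT (RULING D-U, lead g21 2026-08-26; WAVE-U-MANIFEST v3.0 row «SkelFrmBChoiceGeomT» ↦ «SkelFrmFromBChoiceGeomT») of the tree module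
# `Transplant/SkelFrmBChoiceGeomT` onto the carrier `PlanarSkeletonFrmFrom` (frames only, cylinders connected from width `ℓ₀` on)

ORIGINAL TITLE: N2 (frames-only node `SamePDropOfSkeletonFrmFrom₁`, OPEN), WAVE 1 under (R-40): THE GEOMETRIC OBLIGATION OF THE CHOICE FUNCTION OF RECORD —

builds on p205010 (kernel theorem, internal audit signed; external expert review pending) — nothing in this file uses p205010; NOTHING is claimed about the
OPEN node U `SamePDropOfSkeletonFrmFrom₁` (nor U_s / the end state).  Lane `prim-bschramm`, seat `prim-bschramm-p3` gen 26; helper file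
(`--supports stmt-CriticalPhenomena-4575 --as helper`).  PORT RULES r1–r4 of RULING D-U: declaration order and proof texts are those of the original,
byte-identical except (i) the carrier token `PlanarSkeletonFrm ↦ PlanarSkeletonFrmFrom` (binders, `namespace`/`end` lines, qualified names of twinned
declarations), (ii) carrier-FREE declarations of the original (φ-level `Skelφ…` blocks and namespace-only arithmetic residents) are NOT re-declared —
this file imports the original and `export`s the twin-free residents (POLICY T / treatment (m1)); residents whose statement mentions a twinned
constant are copied, (iii) every carrier-binding declaration keeps its explicit binder `(Φ : PlanarSkeletonFrmFrom G)` in its own signature (r2).  Docstrings and citations are the original's.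
-/

noncomputable section

open scoped Classical

namespace Summit.CriticalPhenomena.PercolationContinuityZ3.Theorems.Transplant

open MeasureTheory Literature.Probability.Percolation Literature.Probability.LatticeModels SimpleGraph KNCells
open Literature.Barriers.CriticalPhenomena (HasExponentialGrowth graphBall)

namespace PlanarSkeletonFrmFrom

open SkelConc (Consts)
open BoxProdZ2 (ConcRadiiG)
open Skelφ (oriφ trφ)
open Skelφ.StepI (DataN DataNS OutNS)

namespace NegB

open Neg

section Geom

variable (κ : Consts) {V : Type} [DecidableEq V] [Countable V] {G : SimpleGraph V} [G.LocallyFinite] (Φ : PlanarSkeletonFrmFrom G) (t : V)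
  (p : unitInterval) (D : DataNS V) (g f : ℕ) (c : Fin 2 → ℕ)

/-! ## §1 The column point over the T-staggered centre -/

/-- **THE COLUMN POINT over the T-STAGGERED centre** for the fine map of the (ζ′) chain: for every cube `Q x` of the staggered cells `fcellsT … c` and every radius
`R ≥ NrepA (cenS x) + 1`, a vertex of fine position exactly `cenS x` inside the window span `VWin (Q x) R`. [cite: KozmaNitzan2024, §4 p. 26 ((29): columns)] -/
theorem hcol_fineA_atT (κ : Consts) {V : Type} [DecidableEq V] [Countable V] {G : SimpleGraph V} [G.LocallyFinite] (Φ : PlanarSkeletonFrmFrom G) (t : V) (p : unitInterval) (D : DataNS V) (g : ℕ) (f : ℕ) (c : Fin 2 → ℕ) {φ' : V → Site 2} (hlip : Skelφ.Lip G φ') (hstep : Skelφ.Steps G φ') (hN : EqNumL κ Φ t p D g f) (x : Site 2) {R : ℕ}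
    (hR : NrepA κ Φ t p D g f ((fcellsT κ Φ t p D g f c).cenS x) + 1 ≤ R) :
    ∃ y ∈ Skelφ.VWin G (fineA κ Φ t p D g f φ') t ((fcellsT κ Φ t p D g f c).Q x) R, fineA κ Φ t p D g f φ' y = (fcellsT κ Φ t p D g f c).cenS x := by
  obtain ⟨hn1, hℓ1⟩ := one_le_of_eqNumL κ Φ t p D g f hN
  obtain ⟨r0, r1⟩ := room_fcellsA_at κ Φ t p D g f hN
  have hD := Skelφ.NegPrm.DofA_pos (Aof_pos κ).2 hn1 hℓ1 (hL κ Φ t p D g f) (vL κ Φ t p D g f)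
  exact Skelφ.hcol_fineSkelT (A := Aof κ) (n := (nL κ Φ t p D g f : ℤ)) (h := hL κ Φ t p D g f) (vα := vL κ Φ t p D g f) (vβ := vβL κ Φ t p D g f) hlip hstep t
    (cA_pos κ Φ t p D g f 0) (cA_pos κ Φ t p D g f 1) hD r0 r1 (fcellsT κ Φ t p D g f c) x hR

/-- **`hcol` in the shape `sepGeomSG₂T` consumes**, from a schedule whose cube radii dominate the column radius at the T-staggered centres. [folklore] -/
theorem hcol_fineA_of_schedT (κ : Consts) {V : Type} [DecidableEq V] [Countable V] {G : SimpleGraph V} [G.LocallyFinite] (Φ : PlanarSkeletonFrmFrom G) (t : V) (p : unitInterval) (D : DataNS V) (g : ℕ) (f : ℕ) (c : Fin 2 → ℕ) {φ' : V → Site 2} (hlip : Skelφ.Lip G φ') (hstep : Skelφ.Steps G φ') (hN : EqNumL κ Φ t p D g f) {Λ : ConcRadiiG}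
    (hcolQ : ∀ a x, NrepA κ Φ t p D g f ((fcellsT κ Φ t p D g f c).cenS x) + 1 ≤ Λ.rQ a x) :
    ∀ a x, ∃ y ∈ Skelφ.VWin G (fineA κ Φ t p D g f φ') t ((fcellsT κ Φ t p D g f c).Q x) (Λ.rQ a x),
      fineA κ Φ t p D g f φ' y = (fcellsT κ Φ t p D g f c).cenS x :=
  fun a x => hcol_fineA_atT κ Φ t p D g f c hlip hstep hN x (hcolQ a x)

/-! ## §2 The nine conjuncts for the T-staggered cells with small boxes -/

/-- **THE NINE `GeomHoldsN` CONJUNCTS FOR THE T-STAGGERED CELLS WITH SMALL BOXES, map slot `φ′`** (`cellGeomSG₂bT … b₀` for any `b₀ ≤ 3r`, any creep value `c`).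
[cite: KozmaNitzan2024, §4 pp. 25–29] -/
theorem geom_fineA_at_bT (κ : Consts) {V : Type} [DecidableEq V] [Countable V] {G : SimpleGraph V} [G.LocallyFinite] (Φ : PlanarSkeletonFrmFrom G) (t : V) (p : unitInterval) (D : DataNS V) (g : ℕ) (f : ℕ) (c : Fin 2 → ℕ) {φ' : V → Site 2} (hlip : Skelφ.Lip G φ') (hstep : Skelφ.Steps G φ') (hN : EqNumL κ Φ t p D g f) {Λ : ConcRadiiG}
    (hΛ : Skelφ.WFS2 (fcellsT κ Φ t p D g f c).toPCells2 Λ) (hcolQ : ∀ a x, NrepA κ Φ t p D g f ((fcellsT κ Φ t p D g f c).cenS x) + 1 ≤ Λ.rQ a x)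
    {b₀ : Fin 2 → ℕ} (hb : ∀ i, b₀ i ≤ 3 * (fcellsT κ Φ t p D g f c).r i) :
    (Skelφ.cellGeomSG₂bT G (fineA κ Φ t p D g f φ') (fcellsT κ Φ t p D g f c) t Λ b₀).root = t ∧
      κ.K₀ ≤ (Skelφ.cellGeomSG₂bT G (fineA κ Φ t p D g f φ') (fcellsT κ Φ t p D g f c) t Λ b₀).K ∧
      Skelφ.Lip G (fineA κ Φ t p D g f φ') ∧
      RunGeom G (Skelφ.cellGeomSG₂bT G (fineA κ Φ t p D g f φ') (fcellsT κ Φ t p D g f c) t Λ b₀) ∧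
      AnchGeom (Skelφ.cellGeomSG₂bT G (fineA κ Φ t p D g f φ') (fcellsT κ Φ t p D g f c) t Λ b₀) ∧
      SepGeom₂ G (Skelφ.cellGeomSG₂bT G (fineA κ Φ t p D g f φ') (fcellsT κ Φ t p D g f c) t Λ b₀) ∧
      ExitGeom G (Skelφ.cellGeomSG₂bT G (fineA κ Φ t p D g f φ') (fcellsT κ Φ t p D g f c) t Λ b₀) ∧
      StepsGeom (Skelφ.cellGeomSG₂bT G (fineA κ Φ t p D g f φ') (fcellsT κ Φ t p D g f c) t Λ b₀)
        (Skelφ.faceDataSGT G (fineA κ Φ t p D g f φ') (fcellsT κ Φ t p D g f c) t Λ) ∧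
      LevelGeom G (Skelφ.cellGeomSG₂bT G (fineA κ Φ t p D g f φ') (fcellsT κ Φ t p D g f c) t Λ b₀)
        (Skelφ.faceDataSGT G (fineA κ Φ t p D g f φ') (fcellsT κ Φ t p D g f c) t Λ)
        (Skelφ.levelDataST (fineA κ Φ t p D g f φ') (fcellsT κ Φ t p D g f c)) := by
  have hψ0 := fineA_base_at κ Φ t p D g f φ' hN
  have hlipψ := lip_fineA_at κ Φ t p D g f hlip hN
  have hws := weakSteps_fineA_at κ Φ t p D g f hstep hN
  have hcol := hcol_fineA_of_schedT κ Φ t p D g f c hlip hstep hN hcolQ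
  refine ⟨rfl, (fcellsA_K κ Φ t p D g f).2.1, hlipψ, Skelφ.runGeomSG₂bT _ _ _, Skelφ.anchGeomSG₂bT _ _ _,
    Skelφ.sepGeom₂SG₂bT _ _ _ hΛ hψ0 hlipψ hws hcol, Skelφ.exitGeomSG₂bT _ _ _ hΛ hlipψ hb, Skelφ.stepsGeomSG₂bT _ _ _ hΛ hlipψ hws hb,
    Skelφ.levelGeomSG₂bT _ _ _ hΛ hlipψ hb⟩

end Geom

end NegB

/-! ## §3 The geometric obligation of the choice function of record under (R-40) -/

/-- **`GeomHoldsNQFn (frmChoiceAllQ3T gv fv Pv Sv cv bv)` FOR EVERY SLOT VALUE** — the Geom column obligation of the node theorem at THE CHOICE FUNCTION OF RECORD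
(the T scheme over the per-axis-capped staggered cells; `bOf ≤ 3r` by `bOf_leT`, the column floor at the T-staggered centre by `colQ_schedOfT`, the long clause from
`FactsNS`). [cite: KozmaNitzan2024, §4 pp. 25–29] -/
theorem geomHoldsNQFn_frmChoiceAllQ3T (gv fv : PlanarSkeletonFrmFrom.Neg.FSlot) (Pv : NegB.PSlot) (Sv : NegB.SSlot) (cv : NegB.CSlot) (bv : NegB.BSlot) :
    GeomHoldsNQFn (frmChoiceAllQ3T gv fv Pv Sv cv bv) := by
  intro κ V _ _ G _ Φ hg t ht h1 p hp0 hp1 hC O q hAt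
  obtain ⟨-, -, hR, -, -⟩ := Skelφ.StepI.OutO.FactsO.shared hAt.1.factsO
  obtain ⟨h1', h2, -, h4, h5, h6, h7, h8, h9⟩ := NegB.geom_fineA_at_bT κ Φ t p O.merged (NegB.gOf κ Φ t p O gv) (NegB.fOf κ Φ t p O fv)
    (NegB.cOf κ Φ t p O gv fv cv)
    (NegB.lip_φL κ Φ t p O.D O.DT.toDataN O.ori (NegB.gOf κ Φ t p O gv) (NegB.fOf κ Φ t p O fv))
    (NegB.steps_φL κ Φ t p O.D O.DT.toDataN O.ori (NegB.gOf κ Φ t p O gv) (NegB.fOf κ Φ t p O fv))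
    (NegB.eqNumL_of_factsO κ Φ t p O.D O.DT.toDataN O.ori _ _ hR (Skelφ.StepI.OutO.FactsO.clauses hAt.1.factsO))
    (NegB.schedOfT_WFS2 κ Φ t p O.merged (NegB.gOf κ Φ t p O gv) (NegB.fOf κ Φ t p O fv) (NegB.cOf κ Φ t p O gv fv cv)
      (Sv κ Φ t p O.merged (NegB.gOf κ Φ t p O gv) (NegB.fOf κ Φ t p O fv) q))
    (NegB.colQ_schedOfT κ Φ t p O.merged (NegB.gOf κ Φ t p O gv) (NegB.fOf κ Φ t p O fv) (NegB.cOf κ Φ t p O gv fv cv)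
      (Sv κ Φ t p O.merged (NegB.gOf κ Φ t p O gv) (NegB.fOf κ Φ t p O fv) q))
    (NegB.bOf_leT κ Φ t p O gv fv cv bv)
  exact ⟨h1', h2, h4, h5, h6, h7, h8, h9⟩

end PlanarSkeletonFrmFrom

end Summit.CriticalPhenomena.PercolationContinuityZ3.Theorems.Transplant

end
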